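import Mathlib

/-!
# NegationLens6g9 — kernel for `Cruxes/DescentPerfectToAll/NEGATION-lens6-g9.md` (res-B-lens-6 g9)

[OURS · CANDIDATE] counted 0; nothing here proves resolution in char p.  Resolution in
characteristic `p` is NOT proved.  This file proves NO statement about schemes: it checks

* (K2) the abstract, order-theoretic content of memo Prop 1.2 / Cor 1.3: the SATURATION
  property (S) and its companion (T) of a "boundary with history" are preserved by the
  complete-transform rule (CJS LNM 2270, (4.6)) under a blow-up in a centre on which the
  Hilbert–Samuel function is constant along specialisations, and hold for `O = 𝓑`;
  everything scheme-theoretic is abstracted into hypotheses (a)–(e) listed in the memo;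
* (K1) the polynomial chart identities of the specimen of memo §2 (valid over any
  commutative ring), including the self-similar step of the infinite chain.

No `sorry`, Mathlib only.
-/

set_option linter.dupNamespace false

namespace Summit.ResolutionOfSingularities.ResolutionOfSingularities.Cruxes.DescentPerfectToAll.NegationLens6g9

section K2

/-! ## K2. Saturation is preserved by complete transforms (memo Prop 1.2, Cor 1.3)

Dictionary.  `X`, `X'` : points of the scheme before / after the blow-up, `π : X' → X`.
`spec x y` : `x ∈ closure {y}` (x is a specialisation of y); likewise `spec'`.
`H : X → L`, `H' : X' → L` : Hilbert–Samuel functions into a partial order.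
`I` indexes the old boundary components, `mem i x` : `x ∈ B_i`; on `X'` the components are
`Option I` (`some i` = strict transform `B̃_i`, `none` = the exceptional divisor `E`), `mem'`.
`D x` : `x` lies on the centre.  `O x i` : `B_i ∈ O(x)` (old for `x`).
The complete transform `O'` is rule (4.6): `O'(x') = 𝓑'(x')` if `H'(x') < H(π x')`, and
`O'(x') = {B̃ : B ∈ O(π x')} ∩ 𝓑'(x')` if `H'(x') = H(π x')` (these are the only cases by (a)).
-/

variable {X X' I L : Type*}

/-- (S): saturation. -/
def Saturated (spec : X → X → Prop) (H : X → L) (mem : I → X → Prop) (O : X → I → Prop) : Prop :=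
  ∀ x y i, spec x y → H x = H y → O x i → mem i y → O y i

/-- (T): a component new for `y` stays inside `y`'s HS-stratum along `closure {y}`. -/
def NewStaysInStratum (spec : X → X → Prop) (H : X → L) (mem : I → X → Prop)
    (O : X → I → Prop) : Prop :=
  ∀ x y i, mem i y → ¬ O y i → spec x y → mem i x → H x = H y

/-- The complete transform of the history under rule (4.6), as a predicate on `Option I`. -/
def transformO (π : X' → X) (H : X → L) (H' : X' → L) (mem' : Option I → X' → Prop)
    (O : X → I → Prop) : X' → Option I → Prop :=
  fun x' j => mem' j x' ∧ (H' x' = H (π x') → ∃ i, j = some i ∧ O (π x') i)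

/-- Cor 1.3, first half: `O = 𝓑` is saturated. -/
theorem saturated_of_all_old (spec : X → X → Prop) (H : X → L) (mem : I → X → Prop) :
    Saturated spec H mem (fun x i => mem i x) := by
  intro x y i _ _ _ h; exact h

/-- Cor 1.3, second half: `O = 𝓑` satisfies (T) (vacuously: nothing is new). -/
theorem newStays_of_all_old (spec : X → X → Prop) (H : X → L) (mem : I → X → Prop) :
    NewStaysInStratum spec H mem (fun x i => mem i x) := by
  intro x y i h hn; exact absurd h hn

variable (π : X' → X) (spec : X → X → Prop) (spec' : X' → X' → Prop)
  (H : X → L) (H' : X' → L) (mem : I → X → Prop) (mem' : Option I → X' → Prop)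
  (D : X → Prop) (O : X → I → Prop)

/-- The scheme-theoretic facts (a)–(e) of memo Prop 1.2, as hypotheses. -/
structure TransformFacts [PartialOrder L] : Prop where
  /-- (a) `H` does not increase under permissible blow-ups. -/
  H_le : ∀ x', H' x' ≤ H (π x')
  /-- (b) `π` maps specialisations to specialisations. -/
  spec_map : ∀ x' w', spec' x' w' → spec (π x') (π w')
  /-- (c) upper semicontinuity of `H'` along specialisation. -/
  H'_usc : ∀ x' w', spec' x' w' → H' w' ≤ H' x'
  /-- (d₁) a strict transform lies over its component. -/
  strict_over : ∀ i x', mem' (some i) x' → mem i (π x')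
  /-- (d₂) the exceptional divisor lies over the centre. -/
  exc_over : ∀ x', mem' none x' → D (π x')
  /-- (e) `H` is constant along specialisations inside the centre. -/
  H_const_on_D : ∀ x w, D x → D w → spec x w → H x = H w

/-- Memo Prop 1.2, part (T′). -/
theorem newStays_transform [PartialOrder L] (F : TransformFacts π spec spec' H H' mem mem' D)
    (hT : NewStaysInStratum spec H mem O) :
    NewStaysInStratum spec' H' mem' (transformO π H H' mem' O) := by
  intro x' w' j hmem hnotO hspec hmemx
  -- unpack `¬ O'`
  have hH : H' w' = H (π w') ∧ ¬ ∃ i, j = some i ∧ O (π w') i := by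
    by_contra hc
    apply hnotO
    refine ⟨hmem, fun h => ?_⟩
    by_contra hne
    exact hc ⟨h, hne⟩
  obtain ⟨hHw, hno⟩ := hH
  have hxw : spec (π x') (π w') := F.spec_map _ _ hspec
  -- H(π x') = H(π w') in both cases
  have key : H (π x') = H (π w') := by
    cases j with
    | none => exact F.H_const_on_D _ _ (F.exc_over _ hmemx) (F.exc_over _ hmem) hxw
    | some i =>
        have hni : ¬ O (π w') i := fun h => hno ⟨i, rfl, h⟩
        exact hT _ _ i (F.strict_over _ _ hmem) hni hxw (F.strict_over _ _ hmemx)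
  -- sandwich
  have h1 : H' w' ≤ H' x' := F.H'_usc _ _ hspec
  have h2 : H' x' ≤ H' w' := by
    calc H' x' ≤ H (π x') := F.H_le _
      _ = H (π w') := key
      _ = H' w' := hHw.symm
  exact le_antisymm h2 h1

/-- Memo Prop 1.2, part (S′): saturation is preserved by the complete transform. -/
theorem saturated_transform [PartialOrder L] (F : TransformFacts π spec spec' H H' mem mem' D)
    (hS : Saturated spec H mem O) (hT : NewStaysInStratum spec H mem O) :
    Saturated spec' H' mem' (transformO π H H' mem' O) := by
  intro x' w' j hspec hHeq hOx hmemw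
  refine ⟨hmemw, fun hHw => ?_⟩
  obtain ⟨hmemx, hOx'⟩ := hOx
  have hxw : spec (π x') (π w') := F.spec_map _ _ hspec
  rcases lt_or_eq_of_le (F.H_le x') with hlt | heq
  · -- H'(x') < H(π x'): then H(π x') > H(π w')
    have hgt : H (π w') < H (π x') := by
      calc H (π w') = H' w' := hHw.symm
        _ = H' x' := hHeq.symm
        _ < H (π x') := hlt
    cases j with
    | none =>
        exact absurd (F.H_const_on_D _ _ (F.exc_over _ hmemx) (F.exc_over _ hmemw) hxw)
          (ne_of_gt hgt)
    | some i =>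
        refine ⟨i, rfl, ?_⟩
        by_contra hni
        exact (ne_of_gt hgt)
          (hT _ _ i (F.strict_over _ _ hmemw) hni hxw (F.strict_over _ _ hmemx))
  · -- H'(x') = H(π x'): B' = B̃ with B ∈ O(π x'), and (S) applies downstairs
    obtain ⟨i, rfl, hOi⟩ := hOx' heq
    refine ⟨i, rfl, ?_⟩
    have hHH : H (π x') = H (π w') := by
      calc H (π x') = H' x' := heq.symm
        _ = H' w' := hHeq
        _ = H (π w') := hHw
    exact hS _ _ i hxw hHH hOi (F.strict_over _ _ hmemw)

/-- (O1) for the transform is built in: an old-for-`x'` component contains `x'`. -/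
theorem transformO_mem {x' : X'} {j : Option I} (h : transformO π H H' mem' O x' j) :
    mem' j x' := h.1

/-- Below the old value the transform is the whole boundary at the point (rule (4.6), case `<`). -/
theorem transformO_of_lt [PartialOrder L] {x' : X'} (hlt : H' x' < H (π x')) (j : Option I) :
    transformO π H H' mem' O x' j ↔ mem' j x' := by
  constructor
  · exact fun h => h.1
  · exact fun h => ⟨h, fun heq => absurd heq (ne_of_lt hlt)⟩

/-- At equal value the transform is `{B̃ : B ∈ O(π x')} ∩ 𝓑'(x')` (rule (4.6), case `=`). -/
theorem transformO_of_eq {x' : X'} (heq : H' x' = H (π x')) (j : Option I) :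
    transformO π H H' mem' O x' j ↔ mem' j x' ∧ ∃ i, j = some i ∧ O (π x') i := by
  constructor
  · exact fun h => ⟨h.1, h.2 heq⟩
  · exact fun h => ⟨h.1, fun _ => h.2⟩

end K2

section K1

/-! ## K1. Chart identities of the specimen (memo §2), over any commutative ring -/

variable {R : Type*} [CommRing R]

/-- The date-0 hypersurface `f` and its Tschirnhausen form `y_T² + t²(w² + t²)`. -/
def f0 (a b w : R) : R := (a + b - 2 * w) ^ 2 + (b - w) ^ 2 * (w ^ 2 + (b - w) ^ 2)

theorem f0_tschirnhausen (a b w : R) :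
    f0 a b w = (a + b - 2 * w) ^ 2 + (b - w) ^ 2 * (w ^ 2 + (b - w) ^ 2) := rfl

/-- `f` vanishes to order ≥ 2 along `C = {a = b = w}`: `f ∈ (a - w, b - w)²`, witnessed. -/
theorem f0_in_square_of_ideal_of_C (a b w : R) :
    f0 a b w = (a - w) ^ 2 + 2 * (a - w) * (b - w) + (b - w) ^ 2 * (1 + w ^ 2)
      + (b - w) ^ 4 := by
  unfold f0; ring

/-- Step 0, chart `w` of `Bl_z`: `a = (y - t + 1) w`, `b = (1 + t) w` gives `f = w² f₁`,
`f₁ = y² + t² w² (1 + t²)`. -/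
def f1 (y t w : R) : R := y ^ 2 + t ^ 2 * w ^ 2 * (1 + t ^ 2)

theorem chart_Blz (y t w : R) : f0 ((y - t + 1) * w) ((1 + t) * w) w = w ^ 2 * f1 y t w := by
  unfold f0 f1; ring

/-- The unit part of `G = a b w^{p-2}` in that chart is `U₁ = a₁ b₁ = (y - t + 1)(1 + t)`,
and the natural leaf representative is `U₁ - 1 = y(1 + t) - t²`. -/
def leaf1 (y t : R) : R := y * (1 + t) - t ^ 2

theorem U1_sub_one (y t : R) : (y - t + 1) * (1 + t) - 1 = leaf1 y t := by
  unfold leaf1; ring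

/-- On the near line `ℓ_z = V(y, w)`: `U₁ = 1 - t²` (not a `p`-th power for odd `p`). -/
theorem U1_on_near_line (t : R) : ((0 : R) - t + 1) * (1 + t) = 1 - t ^ 2 := by ring

/-- Step 1, chart `w` of `Bl_c`: `y ↦ y w`, `t ↦ t w`: `f₁ = w² f₂`, `leaf₁ = w · leaf₂`. -/
def f2 (y t w : R) : R := y ^ 2 + t ^ 2 * w ^ 2 * (1 + t ^ 2 * w ^ 2)
def leaf2 (y t w : R) : R := y * (1 + t * w) - t ^ 2 * w

theorem chart_Blc_f (y t w : R) : f1 (y * w) (t * w) w = w ^ 2 * f2 y t w := by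
  unfold f1 f2; ring
theorem chart_Blc_leaf (y t w : R) : leaf1 (y * w) (t * w) = w * leaf2 y t w := by
  unfold leaf1 leaf2; ring

/-- Step 2, chart `w` of `Bl_{ℓ_c}` (`ℓ_c = V(w, y)`): `y ↦ y w`: `f₂ = w² f₃`, `leaf₂ = w · leaf₃`. -/
def f3 (y t w : R) : R := y ^ 2 + t ^ 2 * (1 + t ^ 2 * w ^ 2)
def leaf3 (y t w : R) : R := y * (1 + t * w) - t ^ 2

theorem chart_Bllc_f (y t w : R) : f2 (y * w) t w = w ^ 2 * f3 y t w := by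
  unfold f2 f3; ring
theorem chart_Bllc_leaf (y t w : R) : leaf2 (y * w) t w = w * leaf3 y t w := by
  unfold leaf2 leaf3; ring

/-- The chain: `F_s = y² + t²(1 + t² w^{2+2s})`, `Leaf_s = y(1 + t w^{1+s}) - t² w^s`,
with `F₀ = f₃`, `Leaf₀ = leaf₃`. -/
def F (s : ℕ) (y t w : R) : R := y ^ 2 + t ^ 2 * (1 + t ^ 2 * w ^ (2 + 2 * s))
def Leaf (s : ℕ) (y t w : R) : R := y * (1 + t * w ^ (1 + s)) - t ^ 2 * w ^ s

theorem F_zero (y t w : R) : F 0 y t w = f3 y t w := by unfold F f3; ring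
theorem Leaf_zero (y t w : R) : Leaf 0 y t w = leaf3 y t w := by unfold Leaf leaf3; ring

/-- SELF-SIMILAR STEP (memo §2.2 Step 3+s): blowing up the chain point, chart `w`
(`y ↦ y w`, `t ↦ t w`), reproduces the shape with `s ↦ s + 1`.  Hence the run never stops. -/
theorem chain_step_F (s : ℕ) (y t w : R) : F s (y * w) (t * w) w = w ^ 2 * F (s + 1) y t w := by
  unfold F; ring
theorem chain_step_Leaf (s : ℕ) (y t w : R) :
    Leaf s (y * w) (t * w) w = w * Leaf (s + 1) y t w := by
  unfold Leaf; ring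

/-- At every chain point the quadratic initial form is `y² + t²` plus higher terms:
`F_s - (y² + t²) = t⁴ w^{2+2s}` (so `e = 1`, `Dir = ⟨∂_w⟩ = T C̃`), and `Leaf_s` has linear
part `y` up to the terms `y t w^{1+s} - t² w^s` of degree ≥ 2 for `s ≥ 1`; for `s = 0`
the linear part is still `y` (`leaf₃ = y + y t w - t²`). -/
theorem F_sub_initial (s : ℕ) (y t w : R) : F s y t w - (y ^ 2 + t ^ 2) = t ^ 4 * w ^ (2 + 2 * s) := by
  unfold F; ring
theorem Leaf_sub_linear (s : ℕ) (y t w : R) :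
    Leaf s y t w - y = y * t * w ^ (1 + s) - t ^ 2 * w ^ s := by
  unfold Leaf; ring

/-- Repair R1 on the specimen: blowing up `C̃ = V(y, t)` instead (chart `t`: `y ↦ y t`) gives
`f₁ = t² (y² + w²(1 + t²))`, `leaf₁ = t (y(1 + t) - t)`: the leaf is tilted (`dy - dt`) against
`Dir = ⟨∂_t⟩`, so `e^O = 0` at the near point and the process stops. -/
theorem chart_R1_f (y t w : R) : f1 (y * t) t w = t ^ 2 * (y ^ 2 + w ^ 2 * (1 + t ^ 2)) := by
  unfold f1; ring
theorem chart_R1_leaf (y t : R) : leaf1 (y * t) t = t * (y * (1 + t) - t) := by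
  unfold leaf1; ring

end K1

end Summit.ResolutionOfSingularities.ResolutionOfSingularities.Cruxes.DescentPerfectToAll.NegationLens6g9
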